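import Summits.Langlands.Langlands.Theses.AbelianSurfaceSerre
import Literature.NumberTheory.DiophantineGeometry.BcgpSerreWreathFixedSimilitudeImprimitiveSurfaces
import HarnessLib

/-!
# Crux `AbelianSurfaceSerre.QuadraticImprimitiveSurfaces` (stmt-Langlands-17766), line `Sketch` (reshape v3):
# calibration of the registered stub `stub_wreathReductionFixed` against the corrected named fact,
# and the line in one (conditional) theorem

Cycle 2 of the line (continuation lead c1).  The wave-1 finding (accepted provefact audit
`Literature/NumberTheory/DiophantineGeometry/BcgpSerreWreathFixedSimilitudeImprimitiveSurfaces.lean`):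
the cycle-1 reduction fact `bcgp_serreWreath_implies_quadraticImprimitiveSurfacesModular` lets the
automorphic lift at a wreath residue be symplectic for SOME multiplier, whereas BCGP 2025
Lemma 10.4.1 / §1 / Prop. 7.5.7 fix the central character `|·|²` (`ν ∘ ρ_{π,p} = ε⁻¹`); an induced
residue carries the two similitude classes `ε̄⁻¹`, `ε̄⁻¹χ_K`, so the `∃ μ` bracket over-claims.  The
skeleton was reshaped to the CORRECTED reduction (similitude of the lift pinned to
`ε_p^{-(1+2s)}`, `p - 1 ∣ s`), whose named form
`Literature.NumberTheory.DiophantineGeometry.bcgp_serreWreathFixedSimilitude_implies_quadraticImprimitiveSurfacesModular` is now in the tree (p153517).  This file records, sorry-free: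

* `wreathReductionFixed_iff_fact` — the registered stub `stub_wreathReductionFixed` IS that fact
  (`Iff.rfl`): it neither loses nor gains strength;
* `serreGSp4Wreath_of_serreGSp4WreathFixed` — the new open stub (pinned similitude) IMPLIES the old
  one (`∃ μ`): a fixed-similitude witness is an `∃ μ` witness (so the reshape strengthened the open
  input exactly where the source requires it, and `OrdinarySerreGSp4` (stmt-Langlands-17569) as typed
  sits on the weak side);
* `QuadraticImprimitiveSurfaces_of_wreathFixedFact` — the line in one theorem: the crux from the
  corrected fact and the pinned wreath-Serre statement (a `conditional-result`; the two missing
  inputs are the open statement and a discharge of the printed fact).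

References: Boxer–Calegari–Gee–Pilloni, arXiv:2502.20645, Lemma 10.4.1 + Rem. 10.4.2 (proof p. 146,
type **B**[C₂]), §1 (central character), Prop. 7.5.3 (1), Prop. 7.5.7, Thm. 7.5.8, Thm. 10.2.1,
Rem. 10.2.2 [BoxerCalegariGeePilloni2025]; Faltings 1983, Satz 3–4 [Faltings1983Endlichkeit].
-/

set_option linter.dupNamespace false

namespace Summit.Langlands.Langlands.Cruxes.QuadraticImprimitiveSurfaces.Sketch

/-- **Calibration: the registered stub `stub_wreathReductionFixed` IS the corrected named fact.**
The implication "Serre at the wreath residues with the similitude of the lift pinned to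
`ε_p^{-(1+2s)}`, `p - 1 ∣ s` ⟹ `QuadraticImprimitiveSurfaces`" (antecedent written out, consequent
the route decl by name) is definitionally
`Literature.NumberTheory.DiophantineGeometry.bcgp_serreWreathFixedSimilitude_implies_quadraticImprimitiveSurfacesModular`.
[cite: BoxerCalegariGeePilloni2025, Lemma 10.4.1 proof p. 146 (type B[C₂]), Rem. 10.4.2; Prop. 7.5.7; Thm 10.2.1] -/
theorem wreathReductionFixed_iff_fact :
    ((∃ P₀ : ℕ, ∀ (p : ℕ) [Fact p.Prime], P₀ ≤ p → ∀ (k : Type) [Field k] [CharP k p] [IsAlgClosed k]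
    [TopologicalSpace k] [DiscreteTopology k] (red : Valued.integer (PadicAlgCl p) →+* k) (ρb :
    Literature.NumberTheory.GaloisRepresentations.FramedGaloisRep ℚ k 4),
    ρb.toGaloisRep.IsIrreducible → ρb.IsSymplecticWithMultiplierFun (fun g => (((Units.map
    (ZMod.castHom (dvd_refl p) k).toMonoidHom ((modularCyclotomicCharacter (AlgebraicClosure ℚ)
    (HasEnoughRootsOfUnity.natCard_rootsOfUnity (AlgebraicClosure ℚ) p)).comp
    (MulSemiringAction.toRingAut (Field.absoluteGaloisGroup ℚ) (AlgebraicClosure ℚ)) g))⁻¹ : kˣ) :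
    k)) → (∀ v : IsDedekindDomain.HeightOneSpectrum (NumberField.RingOfIntegers ℚ), ((p : ℕ) :
    NumberField.RingOfIntegers ℚ) ∈ v.asIdeal → ∃ g : Matrix.GeneralLinearGroup (Fin 4) k, (∀ (τ :
    Field.absoluteGaloisGroup (v.adicCompletion ℚ)) (i j : Fin 4), j < i → (g * ρb.toLocal v τ *
    g⁻¹).val i j = 0) ∧ ∀ i j : Fin 4, i ≠ j → ∃ τ : Field.absoluteGaloisGroup (v.adicCompletion ℚ),
    (g * ρb.toLocal v τ * g⁻¹).val i i ≠ (g * ρb.toLocal v τ * g⁻¹).val j j) → Nat.card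
    ρb.toMonoidHom.range = 2 * p ^ 2 * (p - 1) * (p ^ 2 - 1) ^ 2 → (ρb.restrictField
    (CyclotomicField p ℚ)).toGaloisRep.IsIrreducible → (∃ (K : Type) (_ : Field K) (_ : NumberField
    K), Module.finrank ℚ K = 2 ∧ ¬ (ρb.restrictField K).toGaloisRep.IsIrreducible) → ∀ (hcpt :
    Literature.NumberTheory.Automorphic.isCompact_glFiniteIntegralLevel 4 ℚ) (ι : PadicAlgCl p ≃+*
    ℂ), ∃ (π : Literature.NumberTheory.Automorphic.CuspidalAutomorphicRepData 4 ℚ hcpt) (r :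
    Literature.NumberTheory.GaloisRepresentations.FramedGaloisRep ℚ (PadicAlgCl p) 4),
    π.1.IsRegularAlgebraic ∧ (∀ v : IsDedekindDomain.HeightOneSpectrum (NumberField.RingOfIntegers
    ℚ), ((p : ℕ) : NumberField.RingOfIntegers ℚ) ∈ v.asIdeal → π.1.IsUnramifiedAt v) ∧ (∃ s : ℕ,
    (p - 1) ∣ s ∧ r.IsSymplecticWithMultiplierFun (fun g => algebraMap ℚ_[p] (PadicAlgCl p)
    (((((Literature.NumberTheory.GaloisRepresentations.GaloisRep.cyclotomicCharacter ℚ p g)⁻¹ :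
    ℤ_[p]ˣ) : ℤ_[p]) : ℚ_[p]) ^ (1 + 2 * s)))) ∧ (∀ v :
    IsDedekindDomain.HeightOneSpectrum (NumberField.RingOfIntegers ℚ), ((p : ℕ) :
    NumberField.RingOfIntegers ℚ) ∈ v.asIdeal → ∃ a : Fin 4 → ℕ, Function.Injective a ∧
    r.IsGreenbergOrdinaryOfShapeAt v a) ∧ (∀ᶠ v : IsDedekindDomain.HeightOneSpectrum
    (NumberField.RingOfIntegers ℚ) in Filter.cofinite, ∃ α : Multiset ℂ, π.1.HasSatakeParamAt v α ∧
    r.IsUnramifiedAt v ∧ r.HasFrobCharpolyAt v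
    (Literature.NumberTheory.Automorphic.arithFrobPolyOfSatake ι v.residueCard 4 α)) ∧ (∀ᶠ v :
    IsDedekindDomain.HeightOneSpectrum (NumberField.RingOfIntegers ℚ) in Filter.cofinite,
    r.IsUnramifiedAt v ∧ ρb.IsUnramifiedAt v ∧ ∃ (P : Polynomial (Valued.integer (PadicAlgCl p)))
    (Pb : Polynomial k), r.HasFrobCharpolyAt v (P.map (Valued.integer (PadicAlgCl p)).subtype) ∧
    ρb.HasFrobCharpolyAt v Pb ∧ P.map red = Pb)) →
      Summit.Langlands.Langlands.Theses.AbelianSurfaceSerre.QuadraticImprimitiveSurfaces) ↔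
    Literature.NumberTheory.DiophantineGeometry.bcgp_serreWreathFixedSimilitude_implies_quadraticImprimitiveSurfacesModular :=
  Iff.rfl

/-- **The pinned wreath-Serre statement implies the `∃ μ` one** (pure logic: a lift symplectic with
multiplier exactly `ε_p^{-(1+2s)}` is symplectic for some multiplier).  Antecedent = the registered
open stub `stub_serreGSp4WreathFixed`; consequent = the cycle-1/2 open stub (`stub_serreGSp4Wreath`,
the antecedent of the old fact and the consequent of the landed `stub_serreWreath_of_ordinarySerre`).
[folklore] -/
theorem serreGSp4Wreath_of_serreGSp4WreathFixed
    (h : ∃ P₀ : ℕ, ∀ (p : ℕ) [Fact p.Prime], P₀ ≤ p → ∀ (k : Type) [Field k] [CharP k p] [IsAlgClosed k]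
    [TopologicalSpace k] [DiscreteTopology k] (red : Valued.integer (PadicAlgCl p) →+* k) (ρb :
    Literature.NumberTheory.GaloisRepresentations.FramedGaloisRep ℚ k 4),
    ρb.toGaloisRep.IsIrreducible → ρb.IsSymplecticWithMultiplierFun (fun g => (((Units.map
    (ZMod.castHom (dvd_refl p) k).toMonoidHom ((modularCyclotomicCharacter (AlgebraicClosure ℚ)
    (HasEnoughRootsOfUnity.natCard_rootsOfUnity (AlgebraicClosure ℚ) p)).comp
    (MulSemiringAction.toRingAut (Field.absoluteGaloisGroup ℚ) (AlgebraicClosure ℚ)) g))⁻¹ : kˣ) :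
    k)) → (∀ v : IsDedekindDomain.HeightOneSpectrum (NumberField.RingOfIntegers ℚ), ((p : ℕ) :
    NumberField.RingOfIntegers ℚ) ∈ v.asIdeal → ∃ g : Matrix.GeneralLinearGroup (Fin 4) k, (∀ (τ :
    Field.absoluteGaloisGroup (v.adicCompletion ℚ)) (i j : Fin 4), j < i → (g * ρb.toLocal v τ *
    g⁻¹).val i j = 0) ∧ ∀ i j : Fin 4, i ≠ j → ∃ τ : Field.absoluteGaloisGroup (v.adicCompletion ℚ),
    (g * ρb.toLocal v τ * g⁻¹).val i i ≠ (g * ρb.toLocal v τ * g⁻¹).val j j) → Nat.card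
    ρb.toMonoidHom.range = 2 * p ^ 2 * (p - 1) * (p ^ 2 - 1) ^ 2 → (ρb.restrictField
    (CyclotomicField p ℚ)).toGaloisRep.IsIrreducible → (∃ (K : Type) (_ : Field K) (_ : NumberField
    K), Module.finrank ℚ K = 2 ∧ ¬ (ρb.restrictField K).toGaloisRep.IsIrreducible) → ∀ (hcpt :
    Literature.NumberTheory.Automorphic.isCompact_glFiniteIntegralLevel 4 ℚ) (ι : PadicAlgCl p ≃+*
    ℂ), ∃ (π : Literature.NumberTheory.Automorphic.CuspidalAutomorphicRepData 4 ℚ hcpt) (r :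
    Literature.NumberTheory.GaloisRepresentations.FramedGaloisRep ℚ (PadicAlgCl p) 4),
    π.1.IsRegularAlgebraic ∧ (∀ v : IsDedekindDomain.HeightOneSpectrum (NumberField.RingOfIntegers
    ℚ), ((p : ℕ) : NumberField.RingOfIntegers ℚ) ∈ v.asIdeal → π.1.IsUnramifiedAt v) ∧ (∃ s : ℕ,
    (p - 1) ∣ s ∧ r.IsSymplecticWithMultiplierFun (fun g => algebraMap ℚ_[p] (PadicAlgCl p)
    (((((Literature.NumberTheory.GaloisRepresentations.GaloisRep.cyclotomicCharacter ℚ p g)⁻¹ :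
    ℤ_[p]ˣ) : ℤ_[p]) : ℚ_[p]) ^ (1 + 2 * s)))) ∧ (∀ v :
    IsDedekindDomain.HeightOneSpectrum (NumberField.RingOfIntegers ℚ), ((p : ℕ) :
    NumberField.RingOfIntegers ℚ) ∈ v.asIdeal → ∃ a : Fin 4 → ℕ, Function.Injective a ∧
    r.IsGreenbergOrdinaryOfShapeAt v a) ∧ (∀ᶠ v : IsDedekindDomain.HeightOneSpectrum
    (NumberField.RingOfIntegers ℚ) in Filter.cofinite, ∃ α : Multiset ℂ, π.1.HasSatakeParamAt v α ∧
    r.IsUnramifiedAt v ∧ r.HasFrobCharpolyAt v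
    (Literature.NumberTheory.Automorphic.arithFrobPolyOfSatake ι v.residueCard 4 α)) ∧ (∀ᶠ v :
    IsDedekindDomain.HeightOneSpectrum (NumberField.RingOfIntegers ℚ) in Filter.cofinite,
    r.IsUnramifiedAt v ∧ ρb.IsUnramifiedAt v ∧ ∃ (P : Polynomial (Valued.integer (PadicAlgCl p)))
    (Pb : Polynomial k), r.HasFrobCharpolyAt v (P.map (Valued.integer (PadicAlgCl p)).subtype) ∧
    ρb.HasFrobCharpolyAt v Pb ∧ P.map red = Pb)) :
    ∃ P₀ : ℕ, ∀ (p : ℕ) [Fact p.Prime], P₀ ≤ p → ∀ (k : Type) [Field k] [CharP k p] [IsAlgClosed k]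
    [TopologicalSpace k] [DiscreteTopology k] (red : Valued.integer (PadicAlgCl p) →+* k) (ρb :
    Literature.NumberTheory.GaloisRepresentations.FramedGaloisRep ℚ k 4),
    ρb.toGaloisRep.IsIrreducible → ρb.IsSymplecticWithMultiplierFun (fun g => (((Units.map
    (ZMod.castHom (dvd_refl p) k).toMonoidHom ((modularCyclotomicCharacter (AlgebraicClosure ℚ)
    (HasEnoughRootsOfUnity.natCard_rootsOfUnity (AlgebraicClosure ℚ) p)).comp
    (MulSemiringAction.toRingAut (Field.absoluteGaloisGroup ℚ) (AlgebraicClosure ℚ)) g))⁻¹ : kˣ) :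
    k)) → (∀ v : IsDedekindDomain.HeightOneSpectrum (NumberField.RingOfIntegers ℚ), ((p : ℕ) :
    NumberField.RingOfIntegers ℚ) ∈ v.asIdeal → ∃ g : Matrix.GeneralLinearGroup (Fin 4) k, (∀ (τ :
    Field.absoluteGaloisGroup (v.adicCompletion ℚ)) (i j : Fin 4), j < i → (g * ρb.toLocal v τ *
    g⁻¹).val i j = 0) ∧ ∀ i j : Fin 4, i ≠ j → ∃ τ : Field.absoluteGaloisGroup (v.adicCompletion ℚ),
    (g * ρb.toLocal v τ * g⁻¹).val i i ≠ (g * ρb.toLocal v τ * g⁻¹).val j j) → Nat.card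
    ρb.toMonoidHom.range = 2 * p ^ 2 * (p - 1) * (p ^ 2 - 1) ^ 2 → (ρb.restrictField
    (CyclotomicField p ℚ)).toGaloisRep.IsIrreducible → (∃ (K : Type) (_ : Field K) (_ : NumberField
    K), Module.finrank ℚ K = 2 ∧ ¬ (ρb.restrictField K).toGaloisRep.IsIrreducible) → ∀ (hcpt :
    Literature.NumberTheory.Automorphic.isCompact_glFiniteIntegralLevel 4 ℚ) (ι : PadicAlgCl p ≃+*
    ℂ), ∃ (π : Literature.NumberTheory.Automorphic.CuspidalAutomorphicRepData 4 ℚ hcpt) (r :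
    Literature.NumberTheory.GaloisRepresentations.FramedGaloisRep ℚ (PadicAlgCl p) 4),
    π.1.IsRegularAlgebraic ∧ (∀ v : IsDedekindDomain.HeightOneSpectrum (NumberField.RingOfIntegers
    ℚ), ((p : ℕ) : NumberField.RingOfIntegers ℚ) ∈ v.asIdeal → π.1.IsUnramifiedAt v) ∧ (∃ μ :
    Field.absoluteGaloisGroup ℚ → PadicAlgCl p, r.IsSymplecticWithMultiplierFun μ) ∧ (∀ v :
    IsDedekindDomain.HeightOneSpectrum (NumberField.RingOfIntegers ℚ), ((p : ℕ) :
    NumberField.RingOfIntegers ℚ) ∈ v.asIdeal → ∃ a : Fin 4 → ℕ, Function.Injective a ∧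
    r.IsGreenbergOrdinaryOfShapeAt v a) ∧ (∀ᶠ v : IsDedekindDomain.HeightOneSpectrum
    (NumberField.RingOfIntegers ℚ) in Filter.cofinite, ∃ α : Multiset ℂ, π.1.HasSatakeParamAt v α ∧
    r.IsUnramifiedAt v ∧ r.HasFrobCharpolyAt v
    (Literature.NumberTheory.Automorphic.arithFrobPolyOfSatake ι v.residueCard 4 α)) ∧ (∀ᶠ v :
    IsDedekindDomain.HeightOneSpectrum (NumberField.RingOfIntegers ℚ) in Filter.cofinite,
    r.IsUnramifiedAt v ∧ ρb.IsUnramifiedAt v ∧ ∃ (P : Polynomial (Valued.integer (PadicAlgCl p)))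
    (Pb : Polynomial k), r.HasFrobCharpolyAt v (P.map (Valued.integer (PadicAlgCl p)).subtype) ∧
    ρb.HasFrobCharpolyAt v Pb ∧ P.map red = Pb) := by
  obtain ⟨P₀, hP⟩ := h
  refine ⟨P₀, ?_⟩
  intro p _ hp k _ _ _ _ _ red ρb hirr hsymp htri hcard hcyc hK hcpt ι
  obtain ⟨π, r, h1, h2, ⟨s, -, hs⟩, h4, h5, h6⟩ :=
    hP p hp k red ρb hirr hsymp htri hcard hcyc hK hcpt ι
  exact ⟨π, r, h1, h2, ⟨_, hs⟩, h4, h5, h6⟩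

/-- **Line `Sketch` (reshape v3) in one theorem (conditional closure by name).**  GRANTED the
corrected printed reduction (named fact
`Literature.NumberTheory.DiophantineGeometry.bcgp_serreWreathFixedSimilitude_implies_quadraticImprimitiveSurfacesModular`:
BCGP 2025 Lemma 10.4.1 along its proof p. 146 for Galois type **B**[C₂], Rem. 10.4.2, similitude
fixed per Prop. 7.5.7, + descent `GL₄ → GSp₄` + Thm. 10.2.1 + Faltings; unproved in the tree), the
pinned wreath-Serre statement (the registered open stub `stub_serreGSp4WreathFixed`, hypothesis
`hSerre`) gives the crux.  A `conditional-result`.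
[cite: BoxerCalegariGeePilloni2025, Lemma 10.4.1 proof p. 146 (type B[C₂]), Rem. 10.4.2; §1; Prop. 7.5.7; Thm 10.2.1] -/
theorem QuadraticImprimitiveSurfaces_of_wreathFixedFact
    (hX : Literature.NumberTheory.DiophantineGeometry.bcgp_serreWreathFixedSimilitude_implies_quadraticImprimitiveSurfacesModular)
    (hSerre : ∃ P₀ : ℕ, ∀ (p : ℕ) [Fact p.Prime], P₀ ≤ p → ∀ (k : Type) [Field k] [CharP k p] [IsAlgClosed k]
    [TopologicalSpace k] [DiscreteTopology k] (red : Valued.integer (PadicAlgCl p) →+* k) (ρb :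
    Literature.NumberTheory.GaloisRepresentations.FramedGaloisRep ℚ k 4),
    ρb.toGaloisRep.IsIrreducible → ρb.IsSymplecticWithMultiplierFun (fun g => (((Units.map
    (ZMod.castHom (dvd_refl p) k).toMonoidHom ((modularCyclotomicCharacter (AlgebraicClosure ℚ)
    (HasEnoughRootsOfUnity.natCard_rootsOfUnity (AlgebraicClosure ℚ) p)).comp
    (MulSemiringAction.toRingAut (Field.absoluteGaloisGroup ℚ) (AlgebraicClosure ℚ)) g))⁻¹ : kˣ) :
    k)) → (∀ v : IsDedekindDomain.HeightOneSpectrum (NumberField.RingOfIntegers ℚ), ((p : ℕ) :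
    NumberField.RingOfIntegers ℚ) ∈ v.asIdeal → ∃ g : Matrix.GeneralLinearGroup (Fin 4) k, (∀ (τ :
    Field.absoluteGaloisGroup (v.adicCompletion ℚ)) (i j : Fin 4), j < i → (g * ρb.toLocal v τ *
    g⁻¹).val i j = 0) ∧ ∀ i j : Fin 4, i ≠ j → ∃ τ : Field.absoluteGaloisGroup (v.adicCompletion ℚ),
    (g * ρb.toLocal v τ * g⁻¹).val i i ≠ (g * ρb.toLocal v τ * g⁻¹).val j j) → Nat.card
    ρb.toMonoidHom.range = 2 * p ^ 2 * (p - 1) * (p ^ 2 - 1) ^ 2 → (ρb.restrictField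
    (CyclotomicField p ℚ)).toGaloisRep.IsIrreducible → (∃ (K : Type) (_ : Field K) (_ : NumberField
    K), Module.finrank ℚ K = 2 ∧ ¬ (ρb.restrictField K).toGaloisRep.IsIrreducible) → ∀ (hcpt :
    Literature.NumberTheory.Automorphic.isCompact_glFiniteIntegralLevel 4 ℚ) (ι : PadicAlgCl p ≃+*
    ℂ), ∃ (π : Literature.NumberTheory.Automorphic.CuspidalAutomorphicRepData 4 ℚ hcpt) (r :
    Literature.NumberTheory.GaloisRepresentations.FramedGaloisRep ℚ (PadicAlgCl p) 4),
    π.1.IsRegularAlgebraic ∧ (∀ v : IsDedekindDomain.HeightOneSpectrum (NumberField.RingOfIntegers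
    ℚ), ((p : ℕ) : NumberField.RingOfIntegers ℚ) ∈ v.asIdeal → π.1.IsUnramifiedAt v) ∧ (∃ s : ℕ,
    (p - 1) ∣ s ∧ r.IsSymplecticWithMultiplierFun (fun g => algebraMap ℚ_[p] (PadicAlgCl p)
    (((((Literature.NumberTheory.GaloisRepresentations.GaloisRep.cyclotomicCharacter ℚ p g)⁻¹ :
    ℤ_[p]ˣ) : ℤ_[p]) : ℚ_[p]) ^ (1 + 2 * s)))) ∧ (∀ v :
    IsDedekindDomain.HeightOneSpectrum (NumberField.RingOfIntegers ℚ), ((p : ℕ) :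
    NumberField.RingOfIntegers ℚ) ∈ v.asIdeal → ∃ a : Fin 4 → ℕ, Function.Injective a ∧
    r.IsGreenbergOrdinaryOfShapeAt v a) ∧ (∀ᶠ v : IsDedekindDomain.HeightOneSpectrum
    (NumberField.RingOfIntegers ℚ) in Filter.cofinite, ∃ α : Multiset ℂ, π.1.HasSatakeParamAt v α ∧
    r.IsUnramifiedAt v ∧ r.HasFrobCharpolyAt v
    (Literature.NumberTheory.Automorphic.arithFrobPolyOfSatake ι v.residueCard 4 α)) ∧ (∀ᶠ v :
    IsDedekindDomain.HeightOneSpectrum (NumberField.RingOfIntegers ℚ) in Filter.cofinite,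
    r.IsUnramifiedAt v ∧ ρb.IsUnramifiedAt v ∧ ∃ (P : Polynomial (Valued.integer (PadicAlgCl p)))
    (Pb : Polynomial k), r.HasFrobCharpolyAt v (P.map (Valued.integer (PadicAlgCl p)).subtype) ∧
    ρb.HasFrobCharpolyAt v Pb ∧ P.map red = Pb)) :
    Summit.Langlands.Langlands.Theses.AbelianSurfaceSerre.QuadraticImprimitiveSurfaces :=
  hX hSerre

end Summit.Langlands.Langlands.Cruxes.QuadraticImprimitiveSurfaces.Sketch
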